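import Summits.AtomisticToContinuum.BoseEinsteinCondensation.Theorems.BECRewardDescentRewardChordBoundTeleportLemma
import Summits.AtomisticToContinuum.BoseEinsteinCondensation.Theorems.BECInsertionCorrectorStaticResponseBoundTruncationMonotone
import Literature.MathematicalPhysics.QuantumManyBody.PeriodicHardCoreTrialProduct
import Literature.MathematicalPhysics.QuantumManyBody.PeriodicHardCoreTube
import HarnessLib
-- module: Summits.AtomisticToContinuum.BoseEinsteinCondensation.Theorems.BECRewardDescentRewardChordBoundTeleportSaturation

/-!
# Saturation of the zero set on the free region (crux `RewardChordBound`, stmt-AtomisticToContinuum-12876, stub R2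
# `stub_teleportPackage`, helper file 3 = conclusion (α))

For a finite-range profile `v` (zero beyond `R₀ ≥ 0`, hard cores allowed), `L > 0`, `s > 0` and a non-negative
Bose-symmetric `η` of finite maximal form satisfying the rewarded Euler–Lagrange identity: for every slot `i`, at
a.e. `t` of the FREE REGION `U₀ = {t | ∀ j ≠ k, R₀/L < ρⱼₖ(t)}` (nearest-image pair distances) where `η(t) = 0`, the
whole one-particle fibre is `η`-null: `η(t + σᵢ c) = 0` for a.e. `c ∈ (ℝ/ℤ)³`.

Proof. The teleport lemma (helper file 2b) applied to the admissible test classes `θ_m = ι₀(χ_m · 1)`, the embedded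
pair-cut-off core functions `χ_m = ∏_{j<k} θ((ρⱼₖ - R₀/L)/δ_m)` (`Torus.smoothCutProfile`, `δ_m → 0`): they are
Bose-symmetric, non-negative, of finite kinetic energy (core functions) and of ZERO potential energy (where `χ_m ≠ 0`
all nearest-image distances exceed `R₀/L`, so every lattice image is out of range and `W = 0`,
`periodicInteraction_eq_of_lt_pairDist`), and `{χ_m > 0} ↑ U₀`. So the spectral slot average `η - exciteProj N i η`
vanishes a.e. on `{η = 0} ∩ U₀`, and a vanishing slot average of a non-negative class kills the fibre (helper file 1).
For `N ≤ 1` there are no pairs, `U₀` is everything and the constant `e₀` is an admissible test class.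

References: M. Reed, B. Simon, *Methods of Modern Mathematical Physics IV* (1978), Thm XIII.44 [ReedSimonIV1978];
E. H. Lieb, R. Seiringer, J. P. Solovej, J. Yngvason, *The Mathematics of the Bose Gas and its Condensation* (2005),
Ch. 2 (hard-core trial states vanishing near the tubes) [LSSY2005].
-/

noncomputable section

open MeasureTheory Filter Set Complex UnitAddTorus
open scoped ENNReal NNReal Topology InnerProductSpace ComplexConjugate
open Literature.Analysis.FunctionSpaces Literature.Analysis.OperatorTheory Literature.Analysis.InnerProduct

namespace Summit.AtomisticToContinuum.BoseEinsteinCondensation.Cruxes.RewardChordBound.Birth.Teleport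

open Literature.MathematicalPhysics.QuantumManyBody.BoseGas
open Summit.AtomisticToContinuum.BoseEinsteinCondensation.Cruxes.RewardChordBound.Birth.SlotAverage
open Summit.AtomisticToContinuum.BoseEinsteinCondensation.Cruxes.StaticResponseBound.UvThomsonForceWave
  (measurable_zeroProfile lintegral_periodicInteraction_zero_ne_top)

-- The measure on `ℝ/ℤ` is the Haar PROBABILITY measure, as in `PeriodicFormDomain.lean`.
attribute [local instance] Literature.MathematicalPhysics.QuantumManyBody.BoseGas.formDomain_measureSpace
  Literature.MathematicalPhysics.QuantumManyBody.BoseGas.formDomain_isProbabilityMeasure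
  Literature.MathematicalPhysics.QuantumManyBody.BoseGas.formDomain_isProbabilityMeasure_pi

variable {N : ℕ} {L : ℝ} {v : ℝ → ℝ≥0∞}

/-- Local notation for the Hilbert space `L²((ℝ/ℤ)^{3N})`, as in `PeriodicFormDomain.lean`. -/
local notation "L2T " N':max => Lp ℂ 2 (volume : Measure (UnitAddTorus (Fin N' × Fin 3)))

/-- Local notation for the configuration torus `(ℝ/ℤ)^{N×3}`. -/
local notation "TN " N':max => UnitAddTorus (Fin N' × Fin 3)

/-! ### The interaction vanishes on the free region -/

/-- **Out of range, no interaction**: if `v = 0` beyond `R₀` and all nearest-image pair distances of `t` exceed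
`R₀/L`, then `W(fromUnitTorusN L t) = 0` (every lattice image is at distance `≥ L ρⱼₖ > R₀`). [cite: LSSY2005, Ch. 2 (2.1)] -/
theorem periodicInteraction_fromUnitTorusN_eq_zero_of_lt_pairDist (hL : 0 < L) {R₀ : ℝ}
    (hv0 : ∀ r, R₀ < r → v r = 0) {t : TN N} (ht : ∀ i j : Fin N, i < j → R₀ / L < Torus.pairDist i j t) :
    periodicInteraction v L (fromUnitTorusN L t) = 0 := by
  have h := periodicInteraction_eq_of_lt_pairDist (v := v) (v' := (0 : ℝ → ℝ≥0∞)) (a := R₀)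
    (fun ρ hρ => by rw [hv0 ρ hρ]; rfl) hL.le t fun i j hij => by
      have := ht i j hij
      rwa [div_lt_iff₀ hL, mul_comm] at this
  rw [h, periodicInteraction_zeroPotential]

/-! ### The admissible cut-off classes -/

section Cutoff

/-- **The embedded pair cut-off**: for `0 ≤ r`, `0 < δ`, `r + 2δ < 1/2` there is a Bose-symmetric non-negative class
`θ` of finite kinetic energy whose representative is a.e. `L^{3N/2} χ(t)`, `χ = Torus.pairCutoff smoothCutProfile r δ`.
[cite: LSSY2005, Ch. 2] -/
theorem exists_cutoffClass (hL : 0 < L) {r δ : ℝ} (hδ : 0 < δ) (hr : 0 ≤ r) (h2 : r + 2 * δ < 1 / 2) :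
    ∃ θ : L2T N, θ ∈ boseSymmetric N ∧ absLp θ = θ ∧ maxFormKin L θ ≠ ⊤ ∧
      ((θ : TN N → ℂ) =ᵐ[volume] fun t =>
        (((cellScale N L * Torus.pairCutoff Torus.smoothCutProfile r δ t : ℝ)) : ℂ)) := by
  obtain ⟨K, hK⟩ := Torus.exists_isCutProfile_smoothCutProfile
  set Ψ : periodicCore N L := ⟨fun _ => (1 : ℂ), const_mem_periodicCore N L 1⟩ with hΨ
  obtain ⟨Φ, hΦ⟩ := exists_core_coeFn_eq_pairCutoff_mul hL measurable_zeroProfile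
    (lintegral_periodicInteraction_zero_ne_top N L) Ψ hδ hr h2
  refine ⟨(formEmbed hL measurable_zeroProfile (lintegral_periodicInteraction_zero_ne_top N L)
      ⟨graphEmbed hL measurable_zeroProfile (lintegral_periodicInteraction_zero_ne_top N L) Φ,
        graphEmbed_mem_formDomain hL measurable_zeroProfile (lintegral_periodicInteraction_zero_ne_top N L) Φ⟩), formEmbed_graphEmbed_mem_boseSymmetric hL _ _ Φ, ?_, ?_, ?_⟩
  · -- non-negativity of the representative
    refine Lp.ext ?_
    filter_upwards [coeFn_absLp ((formEmbed hL measurable_zeroProfile (lintegral_periodicInteraction_zero_ne_top N L)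
      ⟨graphEmbed hL measurable_zeroProfile (lintegral_periodicInteraction_zero_ne_top N L) Φ,
        graphEmbed_mem_formDomain hL measurable_zeroProfile (lintegral_periodicInteraction_zero_ne_top N L) Φ⟩)), hΦ, coeFn_formEmbed_graphEmbed hL measurable_zeroProfile
      (lintegral_periodicInteraction_zero_ne_top N L) Ψ] with t h1 h2' h3
    rw [h1, h2', h3]
    simp only [hΨ, mul_one]
    rw [mul_comm, ← Complex.ofReal_mul, Complex.norm_real, Real.norm_eq_abs,
      abs_of_nonneg (mul_nonneg (cellScale_nonneg N L) (Torus.pairCutoff_nonneg hK r δ t))]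
  · -- finite kinetic energy: the free maximal form of an embedded core function is finite
    have h := maxForm_formEmbed_graphEmbed_eq_ofReal hL measurable_zeroProfile
      (lintegral_periodicInteraction_zero_ne_top N L) Φ
    have hfin : maxForm (0 : ℝ → ℝ≥0∞) L ((formEmbed hL measurable_zeroProfile (lintegral_periodicInteraction_zero_ne_top N L)
      ⟨graphEmbed hL measurable_zeroProfile (lintegral_periodicInteraction_zero_ne_top N L) Φ,
        graphEmbed_mem_formDomain hL measurable_zeroProfile (lintegral_periodicInteraction_zero_ne_top N L) Φ⟩)) ≠ ⊤ := by rw [h]; exact ENNReal.ofReal_ne_top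
    exact ne_top_of_le_ne_top hfin (self_le_add_right _ _)
  · filter_upwards [hΦ, coeFn_formEmbed_graphEmbed hL measurable_zeroProfile
      (lintegral_periodicInteraction_zero_ne_top N L) Ψ] with t h2' h3
    rw [h2', h3]
    simp only [hΨ, mul_one]
    rw [mul_comm, ← Complex.ofReal_mul]

/-- **The cut-off classes have zero potential energy for a finite-range `v`** (zero beyond `R₀`, `r = R₀/L`): where
the cut-off does not vanish all nearest-image distances exceed `r + δ > R₀/L`. [cite: LSSY2005, Ch. 2 (2.1)] -/
theorem maxFormPot_eq_zero_of_coeFn_cutoff (hL : 0 < L) {R₀ δ : ℝ} (hδ : 0 < δ) (hv0 : ∀ r, R₀ < r → v r = 0) {θ : L2T N}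
    (hθ : (θ : TN N → ℂ) =ᵐ[volume] fun t =>
      (((cellScale N L * Torus.pairCutoff Torus.smoothCutProfile (R₀ / L) δ t : ℝ)) : ℂ)) :
    maxFormPot v L θ = 0 := by
  obtain ⟨K, hK⟩ := Torus.exists_isCutProfile_smoothCutProfile
  unfold maxFormPot
  rw [lintegral_congr_ae (g := fun _ => (0 : ℝ≥0∞)) ?_, lintegral_zero]
  filter_upwards [hθ] with t ht
  by_cases hfree : ∀ i j : Fin N, i < j → R₀ / L < Torus.pairDist i j t
  · rw [periodicInteraction_fromUnitTorusN_eq_zero_of_lt_pairDist hL hv0 hfree, zero_mul]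
  · push Not at hfree
    obtain ⟨i, j, hij, hle⟩ := hfree
    have h0 : Torus.pairCutoff Torus.smoothCutProfile (R₀ / L) δ t = 0 :=
      Torus.pairCutoff_eq_zero hK hδ hij (by linarith)
    rw [ht, h0, mul_zero, Complex.ofReal_zero, nnnorm_zero, ENNReal.coe_zero, zero_pow two_ne_zero, mul_zero]

end Cutoff

/-! ### Saturation (conclusion (α) of the stub) -/

section Saturation

variable {η : L2T N}

/-- **Saturation of the zero set on the free region.** For `L > 0`, measurable `v` vanishing beyond `R₀ ≥ 0`,
`s > 0`, and a non-negative Bose-symmetric `η` of finite maximal form satisfying the rewarded Euler–Lagrange identity: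
for every slot `i`, at a.e. `t` with `η(t) = 0` and all nearest-image pair distances `> R₀/L`, the translates
`η(t + σᵢ c)` vanish for a.e. `c`. [cite: ReedSimonIV1978, Thm XIII.44] -/
theorem saturation (hL : 0 < L) (hv : Measurable v) {R₀ : ℝ} (hv0 : ∀ r, R₀ < r → v r = 0) (hR₀ : 0 ≤ R₀)
    (hroom : (N : ℝ) * (4 / 3 * Real.pi * (R₀ / L) ^ 3) < 1) {s R : ℝ} (hs : 0 < s) (hηs : η ∈ boseSymmetric N) (hη : absLp η = η) (hηf : maxForm v L η ≠ ⊤)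
    (hEL : ∀ ξ : L2T N, ξ ∈ boseSymmetric N → maxForm v L ξ ≠ ⊤ →
      maxFormKinB L η ξ + maxFormPotB v L η ξ + s * depletionB N η ξ = R * (⟪η, ξ⟫_ℂ).re)
    (i : Fin N) :
    ∀ᵐ t : TN N, (η : TN N → ℂ) t = 0 → (∀ j k : Fin N, j ≠ k → R₀ / L < Torus.pairDist j k t) →
      ∀ᵐ c : UnitAddTorus (Fin 3), (η : TN N → ℂ) (t + slotShift i c) = 0 := by
  -- the slot-average step (helper file 1)
  have hSA := stub_teleportPackage_SlotAverage N i η hη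
  -- it suffices to make the spectral slot average vanish a.e. on `{η = 0} ∩ U₀`
  suffices hmain : ∀ᵐ t : TN N, (η : TN N → ℂ) t = 0 → (∀ j k : Fin N, j ≠ k → R₀ / L < Torus.pairDist j k t) →
      ((η - exciteProj N i η : L2T N) : TN N → ℂ) t = 0 by
    filter_upwards [hmain, hSA] with t h1 h2 h0 hfree
    exact h2 (h1 h0 hfree)
  -- the teleport lemma (helper file 2b) for an admissible test class `θ`
  have hT : ∀ θ : L2T N, θ ∈ boseSymmetric N → absLp θ = θ → maxForm v L θ ≠ ⊤ →
      ∀ᵐ t : TN N, (η : TN N → ℂ) t = 0 → (θ : TN N → ℂ) t ≠ 0 →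
        ((η - exciteProj N i η : L2T N) : TN N → ℂ) t = 0 := fun θ hθs hθ hθf =>
    ae_sub_exciteProj_eq_zero_of_eulerLagrange hv hs hηs hη hηf hEL hθs hθ hθf i
  by_cases hN : N ≤ 1
  · -- no pairs: the constant `e₀` is an admissible test class (and `U₀` is everything)
    set e₀ : L2T N := (mFourierLp 2 (0 : Fin N × Fin 3 → ℤ) : L2T N) with he₀
    have hcoe : (e₀ : TN N → ℂ) =ᵐ[volume] fun _ => (1 : ℂ) := by
      filter_upwards [coeFn_mFourierLp 2 (0 : Fin N × Fin 3 → ℤ)] with t ht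
      rw [ht, mFourier_zero, ContinuousMap.one_apply]
    have habs : absLp e₀ = e₀ := by
      refine Lp.ext ?_
      filter_upwards [coeFn_absLp e₀, hcoe] with t h1 h2
      rw [h1, h2, norm_one, Complex.ofReal_one]
    have hK : maxFormKin L e₀ = 0 := by
      have h := maxFormKin_add_smul_mFourierLp_zero L (0 : L2T N) 1
      rw [zero_add, one_smul] at h
      rw [h]
      have h0 := maxFormKin_smul L (0 : ℂ) (0 : L2T N)
      rwa [zero_smul, norm_zero, zero_pow two_ne_zero, ENNReal.ofReal_zero, zero_mul] at h0
    have hW0 : ∀ t : TN N, periodicInteraction v L (fromUnitTorusN L t) = 0 := by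
      intro t
      unfold periodicInteraction
      refine Finset.sum_eq_zero fun a _ => Finset.sum_eq_zero fun b hb => ?_
      have hlt : a < b := (Finset.mem_filter.1 hb).2
      have : (a : ℕ) < 1 := lt_of_lt_of_le b.isLt hN |>.trans_le' (Nat.succ_le_of_lt hlt) |> fun h => by omega
      omega
    have hP : maxFormPot v L e₀ = 0 := by
      unfold maxFormPot
      rw [lintegral_congr (g := fun _ => (0 : ℝ≥0∞)) fun t => by rw [hW0 t, zero_mul], lintegral_zero]
    have hfin : maxForm v L e₀ ≠ ⊤ := by
      rw [maxForm, hK, hP, zero_add]; exact ENNReal.zero_ne_top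
    filter_upwards [hT e₀ mFourierLp_zero_mem_boseSymmetric habs hfin, hcoe] with t h1 h2 h0 _
    exact h1 h0 (by rw [h2]; exact one_ne_zero)
  · -- `N ≥ 2`: the cut-off classes `θ_m`
    push Not at hN
    set r : ℝ := R₀ / L with hrdef
    have hr : 0 ≤ r := div_nonneg hR₀ hL.le
    have hr2 : r < 1 / 2 := by
      -- `N·(4π/3)r³ < 1` with `N ≥ 2` and `π > 3` forces `r³ < 1/8`
      have h1 : (2 : ℝ) ≤ N := by exact_mod_cast hN
      have h3 : 0 ≤ 4 / 3 * Real.pi * r ^ 3 := by positivity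
      have h2 : 2 * (4 / 3 * Real.pi * r ^ 3) < 1 := by nlinarith
      have hpi := Real.pi_gt_three
      have hr3 : r ^ 3 < 1 / 8 := by nlinarith
      by_contra hcon
      push Not at hcon
      have : (1 / 2 : ℝ) ^ 3 ≤ r ^ 3 := by gcongr
      norm_num at this
      linarith
    set c₀ : ℝ := (1 / 2 - r) / 4 with hc₀
    have hc₀pos : 0 < c₀ := by rw [hc₀]; linarith
    set δ : ℕ → ℝ := fun m => c₀ / ((m : ℝ) + 1) with hδdef
    have hδpos : ∀ m, 0 < δ m := fun m => div_pos hc₀pos (Nat.cast_add_one_pos m)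
    have hδle : ∀ m, δ m ≤ c₀ := fun m => div_le_self hc₀pos.le (by linarith [(Nat.cast_nonneg m : (0 : ℝ) ≤ m)])
    have h2δ : ∀ m, r + 2 * δ m < 1 / 2 := fun m => by
      have := hδle m
      rw [hc₀] at this
      linarith
    -- the classes
    choose θ hθs hθabs hθK hθrep using fun m : ℕ => exists_cutoffClass (N := N) hL (hδpos m) hr (h2δ m)
    have hθfin : ∀ m, maxForm v L (θ m) ≠ ⊤ := fun m => by
      rw [maxForm, maxFormPot_eq_zero_of_coeFn_cutoff hL (hδpos m) hv0 (by rw [← hrdef]; exact hθrep m), add_zero]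
      exact hθK m
    have hall := ae_all_iff.2 fun m => hT (θ m) (hθs m) (hθabs m) (hθfin m)
    have hrep := ae_all_iff.2 fun m => hθrep m
    obtain ⟨K, hK⟩ := Torus.exists_isCutProfile_smoothCutProfile
    have hcs : 0 < cellScale N L := Real.sqrt_pos.2 (pow_pos (pow_pos hL 3) N)
    filter_upwards [hall, hrep] with t h1 h2 h0 hfree
    -- a positive margin below all pair distances
    set S : Finset (Fin N × Fin N) := (Finset.univ : Finset (Fin N × Fin N)).filter fun q => q.1 < q.2 with hS
    have hSne : S.Nonempty := ⟨(⟨0, by omega⟩, ⟨1, by omega⟩), by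
      rw [hS, Finset.mem_filter]; exact ⟨Finset.mem_univ _, Fin.mk_lt_mk.2 zero_lt_one⟩⟩
    obtain ⟨q₀, hq₀S, hq₀min⟩ := Finset.exists_min_image S (fun q => Torus.pairDist q.1 q.2 t) hSne
    have hq₀lt : q₀.1 < q₀.2 := (Finset.mem_filter.1 hq₀S).2
    set ε : ℝ := Torus.pairDist q₀.1 q₀.2 t - r with hεdef
    have hε : 0 < ε := by
      have := hfree q₀.1 q₀.2 (ne_of_lt hq₀lt)
      rw [hεdef]; linarith
    -- a level `m` with `2 δ_m ≤ ε`
    obtain ⟨m, hm⟩ := exists_nat_ge (2 * c₀ / ε)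
    have h2δm : 2 * δ m ≤ ε := by
      have hm1 : 2 * c₀ / ε ≤ (m : ℝ) + 1 := hm.trans (by linarith)
      rw [div_le_iff₀ hε] at hm1
      have hδm : δ m = c₀ / ((m : ℝ) + 1) := rfl
      rw [hδm, mul_div_assoc', div_le_iff₀ (Nat.cast_add_one_pos m)]
      nlinarith
    have hone : Torus.pairCutoff Torus.smoothCutProfile r (δ m) t = 1 := by
      refine Torus.pairCutoff_eq_one hK (hδpos m) fun a b hab => ?_
      have hmin := hq₀min (a, b) (by rw [hS, Finset.mem_filter]; exact ⟨Finset.mem_univ _, hab⟩)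
      simp only at hmin
      linarith
    refine h1 m h0 ?_
    rw [h2 m, hone, mul_one, Ne, Complex.ofReal_eq_zero]
    exact hcs.ne'

end Saturation

end Summit.AtomisticToContinuum.BoseEinsteinCondensation.Cruxes.RewardChordBound.Birth.Teleport

namespace Summit.AtomisticToContinuum.BoseEinsteinCondensation.Cruxes.RewardChordBound.Birth

open Summit.AtomisticToContinuum.BoseEinsteinCondensation.Cruxes.RewardChordBound.Birth.Teleport
  Literature.MathematicalPhysics.QuantumManyBody.BoseGas

/-- **Registered sub-goal of stub `stub_teleportPackage` (helper file 3 = conclusion (α), saturation).** In the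
setting of the stub (finite-range `v`, room condition, non-negative Bose-symmetric `η` of finite maximal form with
the rewarded Euler–Lagrange identity): for every slot `i`, at a.e. `t` of `{η = 0} ∩ U₀` the whole one-particle
fibre is `η`-null (explicit Haar product measures). [cite: ReedSimonIV1978, Thm XIII.44] -/
theorem stub_teleportPackage_Saturation :
    ∀ (N : ℕ) (L : ℝ) (v : ℝ → ENNReal) (R₀ s R : ℝ), 0 < L → Measurable v → (∀ r, R₀ < r → v r = 0) →
      0 ≤ R₀ → (N : ℝ) * (4 / 3 * Real.pi * (R₀ / L) ^ 3) < 1 → 0 < s →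
      ∀ η : MeasureTheory.Lp ℂ 2 (MeasureTheory.Measure.pi fun _ : Fin N × Fin 3 =>
          (AddCircle.haarAddCircle : MeasureTheory.Measure UnitAddCircle)),
        η ∈ Literature.MathematicalPhysics.QuantumManyBody.BoseGas.boseSymmetric N → Literature.MathematicalPhysics.QuantumManyBody.BoseGas.absLp η = η → Literature.MathematicalPhysics.QuantumManyBody.BoseGas.maxForm v L η ≠ ⊤ →
        (∀ ξ : MeasureTheory.Lp ℂ 2 (MeasureTheory.Measure.pi fun _ : Fin N × Fin 3 =>
          (AddCircle.haarAddCircle : MeasureTheory.Measure UnitAddCircle)),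
          ξ ∈ Literature.MathematicalPhysics.QuantumManyBody.BoseGas.boseSymmetric N → Literature.MathematicalPhysics.QuantumManyBody.BoseGas.maxForm v L ξ ≠ ⊤ →
            Literature.MathematicalPhysics.QuantumManyBody.BoseGas.maxFormKinB L η ξ + Literature.MathematicalPhysics.QuantumManyBody.BoseGas.maxFormPotB v L η ξ +
              s * Literature.MathematicalPhysics.QuantumManyBody.BoseGas.depletionB N η ξ = R * (⟪η, ξ⟫_ℂ).re) →
        ∀ i : Fin N, ∀ᵐ t ∂(MeasureTheory.Measure.pi fun _ : Fin N × Fin 3 =>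
            (AddCircle.haarAddCircle : MeasureTheory.Measure UnitAddCircle)),
          (η : UnitAddTorus (Fin N × Fin 3) → ℂ) t = 0 →
          (∀ j k : Fin N, j ≠ k → R₀ / L < Literature.Analysis.FunctionSpaces.Torus.pairDist j k t) →
            ∀ᵐ c ∂(MeasureTheory.Measure.pi fun _ : Fin 3 => (AddCircle.haarAddCircle : MeasureTheory.Measure UnitAddCircle)),
              (η : UnitAddTorus (Fin N × Fin 3) → ℂ) (t + Literature.MathematicalPhysics.QuantumManyBody.BoseGas.slotShift i c) = 0 :=
  fun _ _ _ _ _ _ hL hv hv0 hR₀ hroom hs _ hηs hη hηf hEL i =>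
    saturation hL hv hv0 hR₀ hroom hs hηs hη hηf hEL i

end Summit.AtomisticToContinuum.BoseEinsteinCondensation.Cruxes.RewardChordBound.Birth

end
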